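import Literature.MathematicalPhysics.QuantumFieldTheory.ONArchipelagoSingletHead
import Literature.MathematicalPhysics.QuantumFieldTheory.ONArchipelagoVectorHead
import Literature.MathematicalPhysics.QuantumFieldTheory.ConformalBootstrap3D.MixedHeadBound
import HarnessLib

/-!
# `O(N)` archipelago certificates: light-row cells that START AT THE UNITARITY BOUND

Thirteenth file of the archipelago rung; the port of `ConformalBootstrap3D/MixedHeadBound` (the
`σ–ε` chain's bound cells) to the archipelago rows.

The spinning items of `ArchipelagoObligations` are closed at the bound: `spinning_S`, `spinning_V`
(and `spinning_T`, `spinning_A`) ask positivity for `ℓ + 1 ≤ Δ < E₀`.  The interval-table cells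
`singletCell_of_headNumbers` (`ONArchipelagoSingletHead`) and `vectorCell_of_headNumber`
(`ONArchipelagoVectorHead`) need `a > unitarityBound3D ℓ` (their tables divide by the Casimir pivot
at `a`), so — exactly as for the `σ–ε` spin rows before `MixedHeadBound` — the first cell `[ℓ+1,
t₁)` of a spinning `S` or `V` row could not be certified by them, and the cell-list glue
`spinning_S_of_cells`, `spinning_V_of_cells` (`t₀ ≤ ℓ + 1`) had no certified first cell to consume.
(The `T` and `A` rows are not affected: `headCell₂_twoSign_of_rules` of `TwoSignHeadCells` already
offers the monotone coefficient mode `ℓ + 1 ≤ a`.)  This file supplies the two missing BOUND CELLS: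
* `S` rows (`2×2`, blocks with equal external dimensions): the head argument of
  `singletPositive_ofPoints_of_headSumsI` verbatim with the MONOTONE tables `hrCoeffMLo/MHi a b ℓ`
  of `MixedHeadBound` (`hrCoeff_monotone_sandwich`, valid from `a = ℓ + 1`):
  `singletPositive_ofPoints_of_headSumsM[_Ico]`, numbers `singletHeadXM/YM/ZM`, cell theorem
  `singletCellM_of_headNumbers (ha : ℓ + 1 ≤ a)`;
* `V` rows (`ℓ ≥ 1`; the `g^{±Δ_φs}` blocks have a simple pole at the bound): through the exact odd
  bridge (`vectorPositive_ofPoints_iff`, `oddWeights`) from `oddCellBd_of_headNumber` of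
  `MixedHeadBound`, whose number `oddHeadNumberBd` uses the tables `hrCoeffABBdLo/Hi` of the
  residue-scaled array `(Δ-ℓ-1)·A_{n,j}(c,c;Δ,ℓ)`: `vectorHeadNumberBd`, `vectorCellBd_of_headNumber
  (hℓ : 1 ≤ ℓ) (ha : ℓ + 1 ≤ a)`.

With these, `spinning_S_of_cells` / `spinning_V_of_cells` are fed a first cell starting at `t₀ = ℓ +
1` and the remaining cells by either mode (`spinning_S_of_cells_bound`,
`spinning_V_of_cells_bound`).  Non-regular points of a cell (the bound itself included) are reached
by the right-limit clause, as in every `_Ico` theorem of the chain.  What stays outside every table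
of the chain: a SCALAR row reaching down to `Δ = 1/2` (a sector with no gap above the `ℓ = 0`
bound), where `A_{2,0}` has its pole — archipelago certificates carry gaps `Δ^* > 1/2` in all three
scalar rows, so the scalar items start strictly above it.  Elementary algebra over the imported
rules; no new estimate, no table of numbers, no `sorry`.

Sources: arXiv:1504.07997 §2.2 (`KosPolandSimmonsDuffinVichi2015`: rows from the unitarity bound
on); F. Kos, D. Poland, D. Simmons-Duffin, JHEP 11 (2014) 109, §3.3 eq. (3.16)
(`KosPolandSimmonsduffin2014`); F. A. Dolan, H. Osborn, Nucl. Phys. B 678 (2004) 491, §3 eq. (3.11)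
(`DolanOsborn2004`: the pole factor of the unequal-dimension array); M. Hogervorst, S. Rychkov,
Phys. Rev. D 87 (2013) 106004, §3 eq. (3.9) (`HogervorstRychkov2013`).
-/

noncomputable section

namespace Literature.MathematicalPhysics.QuantumFieldTheory.ONArchipelagoSystem

open Finset Set Filter Topology
open ConformalBootstrap3D (IsConformalBlock3D IsRegularPoint3D unitarityBound3D accidentalDegeneracy3D
  InDescendantRange crossF CrossingFunctional pointFunctional zMono hrCoeff hrCoeffMLo hrCoeffMHi legendreLam
  legendreLam_pos hrCoeff_monotone_sandwich headCellSumM headAbsSumM min_mul_le_mul_of_bounds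
  quadForm_nonneg_of_det twoWeightEval sum45_eq_twoWeightEval twoWeightEval_neg cornerBound₂ cornerBound₂_le
  termCornerBound termCornerBound_le apexRest headSet headSet_off unitarityBound3D_le_add_one
  eventually_isRegularPoint3D_nhdsGT_of_bound_le oddDomEval oddHeadNumberBd oddHeadCellSumBd
  oddCellBd_of_headNumber hrCoeffABBdLo hrCoeffABBdHi)

namespace ArchipelagoFunctional

/-! ### `S` rows: the head rule with the monotone tables -/

/-- **Singlet head cell rule, regular points.** MONOTONE tables: cell `[a, b]` with `ℓ + 1 ≤ a` (so it may start AT the bound of a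
spinning row); `Φ¹lo` bounds the two-weight `(1,1)` head terms and `Φ²lo` the `(2,2)` head terms from below and
`Zabs` the off-diagonal head terms in absolute value, uniformly on the cell; the three numbers satisfy
`X_lo ≥ 0`, `Y_lo ≥ 0`, `Z_abs² ≤ 4 X_lo Y_lo`; every singlet term form off `F` on the descendant range
is PSD for `E ∈ [a+n, b+n]`. Then `SingletPositive` at every REGULAR `Δ ∈ [a, b]`.
[cite: KosPolandSimmonsduffin2014, §3.3 eq. (3.16)] -/
theorem singletPositive_ofPoints_of_headSumsM {N : ℕ} (z zb : Fin N → ℝ) (w : Fin 7 → Fin N → ℝ)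
    (hz : ∀ k, z k ∈ Ioo (0 : ℝ) 1) (hzb : ∀ k, zb k ∈ Ioo (0 : ℝ) 1) {ℓ : ℕ} {a b Δφ Δs : ℝ}
    (ha : (ℓ : ℝ) + 1 ≤ a) (F : Finset (ℕ × ℕ)) (Φ₁lo Φ₂lo Zabs : ℕ × ℕ → ℝ)
    (hΦ₁ : ∀ q ∈ F, ∀ Δ ∈ Icc a b,
      Φ₁lo q ≤ pointFunctional (w 1) z zb (crossF Δφ (-1) (zMono (Δ + (q.1 : ℝ)) q.2)) +
        pointFunctional (w 2) z zb (crossF Δφ 1 (zMono (Δ + (q.1 : ℝ)) q.2)))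
    (hΦ₂ : ∀ q ∈ F, ∀ Δ ∈ Icc a b,
      Φ₂lo q ≤ pointFunctional (w 3) z zb (crossF Δs (-1) (zMono (Δ + (q.1 : ℝ)) q.2)))
    (hZ : ∀ q ∈ F, ∀ Δ ∈ Icc a b,
      |pointFunctional (w 5) z zb (crossF ((Δφ + Δs) / 2) (-1) (zMono (Δ + (q.1 : ℝ)) q.2)) +
        pointFunctional (w 6) z zb (crossF ((Δφ + Δs) / 2) 1 (zMono (Δ + (q.1 : ℝ)) q.2))| ≤ Zabs q)
    (hX : 0 ≤ headCellSumM ℓ a b F Φ₁lo) (hY : 0 ≤ headCellSumM ℓ a b F Φ₂lo)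
    (hdet : headAbsSumM ℓ a b F Zabs ^ 2 ≤ 4 * headCellSumM ℓ a b F Φ₁lo * headCellSumM ℓ a b F Φ₂lo)
    (htail : ∀ q : ℕ × ℕ, q ∉ F → InDescendantRange ℓ q.1 q.2 →
      ∀ E ∈ Icc (a + q.1) (b + q.1), ∀ x y : ℝ, 0 ≤ singletTermForm z zb w Δφ Δs E q.2 x y) :
    ∀ Δ ∈ Icc a b, IsRegularPoint3D Δ ℓ → (ofPoints z zb w).SingletPositive Δφ Δs Δ ℓ := by
  intro Δ hΔ hreg
  have hbd : unitarityBound3D ℓ ≤ Δ := ((unitarityBound3D_le_add_one ℓ).trans ha).trans hΔ.1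
  have hlt : unitarityBound3D ℓ < Δ := lt_of_le_of_ne hbd (fun h => hreg.1 h.symm)
  have hlam : 0 < legendreLam ℓ := legendreLam_pos ℓ
  refine singletPositive_ofPoints_of_termwise z zb w hz hzb hlt hreg.2 F ?_ ?_
  · intro x y
    rw [sum_singletTermForm_eq]
    set c : ℕ × ℕ → ℝ := fun q => hrCoeff Δ ℓ q.1 q.2 / legendreLam ℓ with hc
    set X := ∑ q ∈ F, c q *
        (pointFunctional (w 1) z zb (crossF Δφ (-1) (zMono (Δ + (q.1 : ℝ)) q.2)) +
          pointFunctional (w 2) z zb (crossF Δφ 1 (zMono (Δ + (q.1 : ℝ)) q.2)))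
    set Y := ∑ q ∈ F, c q * pointFunctional (w 3) z zb (crossF Δs (-1) (zMono (Δ + (q.1 : ℝ)) q.2))
    set W := ∑ q ∈ F, c q *
        (pointFunctional (w 5) z zb (crossF ((Δφ + Δs) / 2) (-1) (zMono (Δ + (q.1 : ℝ)) q.2)) +
          pointFunctional (w 6) z zb (crossF ((Δφ + Δs) / 2) 1 (zMono (Δ + (q.1 : ℝ)) q.2)))
    have hA : ∀ q : ℕ × ℕ, 0 ≤ hrCoeffMLo a b ℓ q.1 q.2 ∧ hrCoeffMLo a b ℓ q.1 q.2 ≤ hrCoeff Δ ℓ q.1 q.2 ∧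
        hrCoeff Δ ℓ q.1 q.2 ≤ hrCoeffMHi a b ℓ q.1 q.2 :=
      fun q => hrCoeff_monotone_sandwich ha hΔ.1 hΔ.2 q.1 q.2
    -- diagonal entries: `X ≥ X_lo/λ`, `Y ≥ Y_lo/λ`
    have hXlo : headCellSumM ℓ a b F Φ₁lo / legendreLam ℓ ≤ X := by
      rw [headCellSumM, Finset.sum_div]
      refine Finset.sum_le_sum fun q hq => ?_
      have hmin := min_mul_le_mul_of_bounds (hA q).2.1 (hA q).2.2 ((hA q).1.trans (hA q).2.1)
        (hΦ₁ q hq Δ hΔ)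
      have hrw : c q *
          (pointFunctional (w 1) z zb (crossF Δφ (-1) (zMono (Δ + (q.1 : ℝ)) q.2)) +
            pointFunctional (w 2) z zb (crossF Δφ 1 (zMono (Δ + (q.1 : ℝ)) q.2))) =
          hrCoeff Δ ℓ q.1 q.2 *
            (pointFunctional (w 1) z zb (crossF Δφ (-1) (zMono (Δ + (q.1 : ℝ)) q.2)) +
              pointFunctional (w 2) z zb (crossF Δφ 1 (zMono (Δ + (q.1 : ℝ)) q.2))) /
              legendreLam ℓ := by
        simp only [hc]; ring
      rw [hrw]
      exact div_le_div_of_nonneg_right hmin hlam.le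
    have hYlo : headCellSumM ℓ a b F Φ₂lo / legendreLam ℓ ≤ Y := by
      rw [headCellSumM, Finset.sum_div]
      refine Finset.sum_le_sum fun q hq => ?_
      have hmin := min_mul_le_mul_of_bounds (hA q).2.1 (hA q).2.2 ((hA q).1.trans (hA q).2.1)
        (hΦ₂ q hq Δ hΔ)
      have hrw : c q * pointFunctional (w 3) z zb (crossF Δs (-1) (zMono (Δ + (q.1 : ℝ)) q.2)) =
          hrCoeff Δ ℓ q.1 q.2 *
            pointFunctional (w 3) z zb (crossF Δs (-1) (zMono (Δ + (q.1 : ℝ)) q.2)) /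
              legendreLam ℓ := by
        simp only [hc]; ring
      rw [hrw]
      exact div_le_div_of_nonneg_right hmin hlam.le
    -- off-diagonal entry: `|W| ≤ Z_abs/λ`
    have hWabs : |W| ≤ headAbsSumM ℓ a b F Zabs / legendreLam ℓ := by
      rw [headAbsSumM, Finset.sum_div]
      refine (Finset.abs_sum_le_sum_abs _ _).trans (Finset.sum_le_sum fun q hq => ?_)
      rw [abs_mul, abs_of_nonneg (div_nonneg ((hA q).1.trans (hA q).2.1) hlam.le)]
      have hZq := hZ q hq Δ hΔ
      have hZ0 : 0 ≤ Zabs q := (abs_nonneg _).trans hZq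
      calc hrCoeff Δ ℓ q.1 q.2 / legendreLam ℓ * |_| ≤ hrCoeff Δ ℓ q.1 q.2 / legendreLam ℓ * Zabs q :=
            mul_le_mul_of_nonneg_left hZq (div_nonneg ((hA q).1.trans (hA q).2.1) hlam.le)
        _ ≤ hrCoeffMHi a b ℓ q.1 q.2 * Zabs q / legendreLam ℓ := by
            rw [div_mul_eq_mul_div]
            exact div_le_div_of_nonneg_right (mul_le_mul_of_nonneg_right (hA q).2.2 hZ0) hlam.le
    have hX0 : 0 ≤ headCellSumM ℓ a b F Φ₁lo / legendreLam ℓ := div_nonneg hX hlam.le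
    have hY0 : 0 ≤ headCellSumM ℓ a b F Φ₂lo / legendreLam ℓ := div_nonneg hY hlam.le
    have hXpos : 0 ≤ X := hX0.trans hXlo
    have hYpos : 0 ≤ Y := hY0.trans hYlo
    refine quadForm_nonneg_of_det hXpos hYpos ?_ x y
    have hW2 : W ^ 2 ≤ (headAbsSumM ℓ a b F Zabs / legendreLam ℓ) ^ 2 := by
      have h1 : -(headAbsSumM ℓ a b F Zabs / legendreLam ℓ) ≤ W := by
        linarith [neg_abs_le W]
      exact sq_le_sq' h1 ((le_abs_self W).trans hWabs)
    have hdet' : (headAbsSumM ℓ a b F Zabs / legendreLam ℓ) ^ 2 ≤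
        4 * (headCellSumM ℓ a b F Φ₁lo / legendreLam ℓ) *
          (headCellSumM ℓ a b F Φ₂lo / legendreLam ℓ) := by
      rw [div_pow]
      have hre : 4 * (headCellSumM ℓ a b F Φ₁lo / legendreLam ℓ) *
          (headCellSumM ℓ a b F Φ₂lo / legendreLam ℓ) =
          4 * headCellSumM ℓ a b F Φ₁lo * headCellSumM ℓ a b F Φ₂lo / legendreLam ℓ ^ 2 := by
        field_simp
      rw [hre]
      exact div_le_div_of_nonneg_right hdet (sq_nonneg _)
    calc W ^ 2 ≤ (headAbsSumM ℓ a b F Zabs / legendreLam ℓ) ^ 2 := hW2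
      _ ≤ 4 * (headCellSumM ℓ a b F Φ₁lo / legendreLam ℓ) *
            (headCellSumM ℓ a b F Φ₂lo / legendreLam ℓ) := hdet'
      _ ≤ 4 * X * Y :=
          mul_le_mul (mul_le_mul_of_nonneg_left hXlo (by norm_num)) hYlo hY0
            (mul_nonneg (by norm_num) hXpos)
  · intro q hq hr x y
    exact htail q hq hr (Δ + (q.1 : ℝ)) ⟨by linarith [hΔ.1], by linarith [hΔ.2]⟩ x y

/-- **Singlet head cell rule, half-open cell**: every `Δ ∈ [a, b)`, non-regular points by the limit
clause from the regular points to their right inside the cell.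
[cite: KosPolandSimmonsduffin2014, §3.3 eq. (3.16)] -/
theorem singletPositive_ofPoints_of_headSumsM_Ico {N : ℕ} (z zb : Fin N → ℝ)
    (w : Fin 7 → Fin N → ℝ) (hz : ∀ k, z k ∈ Ioo (0 : ℝ) 1) (hzb : ∀ k, zb k ∈ Ioo (0 : ℝ) 1)
    {ℓ : ℕ} {a b Δφ Δs : ℝ} (ha : (ℓ : ℝ) + 1 ≤ a) (F : Finset (ℕ × ℕ))
    (Φ₁lo Φ₂lo Zabs : ℕ × ℕ → ℝ)
    (hΦ₁ : ∀ q ∈ F, ∀ Δ ∈ Icc a b,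
      Φ₁lo q ≤ pointFunctional (w 1) z zb (crossF Δφ (-1) (zMono (Δ + (q.1 : ℝ)) q.2)) +
        pointFunctional (w 2) z zb (crossF Δφ 1 (zMono (Δ + (q.1 : ℝ)) q.2)))
    (hΦ₂ : ∀ q ∈ F, ∀ Δ ∈ Icc a b,
      Φ₂lo q ≤ pointFunctional (w 3) z zb (crossF Δs (-1) (zMono (Δ + (q.1 : ℝ)) q.2)))
    (hZ : ∀ q ∈ F, ∀ Δ ∈ Icc a b,
      |pointFunctional (w 5) z zb (crossF ((Δφ + Δs) / 2) (-1) (zMono (Δ + (q.1 : ℝ)) q.2)) +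
        pointFunctional (w 6) z zb (crossF ((Δφ + Δs) / 2) 1 (zMono (Δ + (q.1 : ℝ)) q.2))| ≤ Zabs q)
    (hX : 0 ≤ headCellSumM ℓ a b F Φ₁lo) (hY : 0 ≤ headCellSumM ℓ a b F Φ₂lo)
    (hdet : headAbsSumM ℓ a b F Zabs ^ 2 ≤ 4 * headCellSumM ℓ a b F Φ₁lo * headCellSumM ℓ a b F Φ₂lo)
    (htail : ∀ q : ℕ × ℕ, q ∉ F → InDescendantRange ℓ q.1 q.2 →
      ∀ E ∈ Icc (a + q.1) (b + q.1), ∀ x y : ℝ, 0 ≤ singletTermForm z zb w Δφ Δs E q.2 x y) :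
    ∀ Δ ∈ Ico a b, (ofPoints z zb w).SingletPositive Δφ Δs Δ ℓ := by
  intro Δ hΔ
  have hreg := singletPositive_ofPoints_of_headSumsM z zb w hz hzb ha F Φ₁lo Φ₂lo Zabs hΦ₁ hΦ₂ hZ hX
    hY hdet htail
  by_cases hr : IsRegularPoint3D Δ ℓ
  · exact hreg Δ ⟨hΔ.1, hΔ.2.le⟩ hr
  · have hbd : unitarityBound3D ℓ ≤ Δ := ((unitarityBound3D_le_add_one ℓ).trans ha).trans hΔ.1
    refine singletPositive_ofPoints_of_eventually_right z zb w hz hzb Δφ Δs Δ ℓ hr ?_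
    filter_upwards [eventually_isRegularPoint3D_nhdsGT_of_bound_le hbd, Ioo_mem_nhdsGT hΔ.2]
      with Δ' hΔ'reg hΔ'
    exact ⟨hΔ'reg, hreg Δ' ⟨hΔ.1.trans hΔ'.1.le, hΔ'.2.le⟩ hΔ'reg⟩

/-! ### The monotone cell numbers and the bound cell of an `S` row -/

/-- The three numbers of a singlet head cell with the MONOTONE tables, on the canonical head set:
`X_lo` (`(1,1)` entry, the two-weight corner bound with `(w₁+w₂, w₁−w₂)` on `[φ_lo,φ_hi]`), `Y_lo` (`(2,2)` entry, corner term
bound of `w₃` on `[s_lo,s_hi]`), `Z_abs` (off-diagonal, on the `h`-box `[(φ_lo+s_lo)/2, (φ_hi+s_hi)/2]`).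
[cite: KosPolandSimmonsduffin2014, §3.3 eq. (3.16)] -/
def singletHeadXM {N : ℕ} (z zb : Fin N → ℝ) (w : Fin 7 → Fin N → ℝ) (ℓ : ℕ) (a b φlo φhi : ℝ)
    (nF : ℕ) : ℝ :=
  headCellSumM ℓ a b (headSet ℓ nF)
    (fun q => cornerBound₂ (w 1 + w 2) (w 1 - w 2) z zb q.2 (a + q.1) (b + q.1) φlo φhi)

/-- See `singletHeadXM`. [cite: KosPolandSimmonsduffin2014, §3.3 eq. (3.16)] -/
def singletHeadYM {N : ℕ} (z zb : Fin N → ℝ) (w : Fin 7 → Fin N → ℝ) (ℓ : ℕ) (a b slo shi : ℝ)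
    (nF : ℕ) : ℝ :=
  headCellSumM ℓ a b (headSet ℓ nF)
    (fun q => termCornerBound (w 3) z zb q.2 (a + q.1) (b + q.1) slo shi)

/-- See `singletHeadXM`. [cite: KosPolandSimmonsduffin2014, §3.3 eq. (3.16)] -/
def singletHeadZM {N : ℕ} (z zb : Fin N → ℝ) (w : Fin 7 → Fin N → ℝ) (ℓ : ℕ)
    (a b φlo φhi slo shi : ℝ) (nF : ℕ) : ℝ :=
  headAbsSumM ℓ a b (headSet ℓ nF)
    (fun q => singletOffDiagAbs z zb w q.2 (a + q.1) (b + q.1) ((φlo + slo) / 2) ((φhi + shi) / 2))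

/-- **One light singlet cell from its three numbers.** In the dominated configuration (apex `a₀`),
for `(Δ_φ, Δ_s) ∈ Q ⊆ [φ_lo,φ_hi] × [s_lo,s_hi]`, with the singlet tail rules in force — (M_S) boxes on
`[E₀, E_T)` (`hM`, from `singletTermForm_nonneg_of_cornerBounds`) and the (T_S) apex numbers of
`singletTermForm_nonneg_of_apex` —, a `Δ`-cell `[a, b)` with `ℓ + 1 ≤ a` (the first cell of a spinning row may START AT
the bound) and `a ≥ ℓ + τ`, head level `n_F` with `a + n_F + 1 ≥ E₀`, and `X_lo ≥ 0`, `Y_lo ≥ 0`,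
`Z_abs² ≤ 4 X_lo Y_lo` give `SingletPositive` for every `p ∈ Q` at every `Δ ∈ [a, b)`.  The items
`scalar_S`, `spinning_S` are finite unions of such cells. [cite: KosPolandSimmonsduffin2014, §3.3 eq. (3.16)] -/
theorem singletCellM_of_headNumbers {N : ℕ} (z zb : Fin N → ℝ) (w : Fin 7 → Fin N → ℝ)
    (hz : ∀ k, z k ∈ Ioo (0 : ℝ) 1) (hzb : ∀ k, zb k ∈ Ioo (0 : ℝ) 1) (hord : ∀ k, zb k ≤ z k)
    (a₀ : Fin N) (qd qr : Fin N → ℝ) (hqd : ∀ k, 0 < qd k ∧ qd k ≤ 1)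
    (hqr : ∀ k, 0 < qr k ∧ qr k ≤ 1)
    (hdomd : ∀ k, z k * zb k ≤ qd k ^ 2 * (z a₀ * zb a₀) ∧ z k ≤ qd k * z a₀)
    (hdomr : ∀ k, (1 - z k) * (1 - zb k) ≤ qr k ^ 2 * (z a₀ * zb a₀) ∧ 1 - zb k ≤ qr k * z a₀)
    {Q : Set (ℝ × ℝ)} {φlo φhi slo shi E₀ ET τ : ℝ}
    (hQ : ∀ p ∈ Q, (φlo ≤ p.1 ∧ p.1 ≤ φhi) ∧ (slo ≤ p.2 ∧ p.2 ≤ shi))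
    (hM : ∀ (j : ℕ) (E : ℝ), E₀ ≤ E → E < ET → (j : ℝ) + τ ≤ E → ∀ p ∈ Q,
      ∀ x y : ℝ, 0 ≤ singletTermForm z zb w p.1 p.2 E j x y)
    (h12 : 0 ≤ w 1 a₀ + w 2 a₀) (h3 : 0 ≤ w 3 a₀)
    (hXT : 0 ≤ (w 1 a₀ + w 2 a₀) * ((1 - z a₀) * (1 - zb a₀)) ^ φhi
      - apexRest (w 1) z zb a₀ qd qr φlo ET - apexRest (w 2) z zb a₀ qd qr φlo ET)
    (hYT : 0 ≤ w 3 a₀ * ((1 - z a₀) * (1 - zb a₀)) ^ shi - apexRest (w 3) z zb a₀ qd qr slo ET)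
    (hZT : (|w 5 a₀ + w 6 a₀| * ((1 - z a₀) * (1 - zb a₀)) ^ ((φlo + slo) / 2)
            + apexRest (w 5) z zb a₀ qd qr ((φlo + slo) / 2) ET
            + apexRest (w 6) z zb a₀ qd qr ((φlo + slo) / 2) ET) ^ 2 ≤
        4 * ((w 1 a₀ + w 2 a₀) * ((1 - z a₀) * (1 - zb a₀)) ^ φhi
              - apexRest (w 1) z zb a₀ qd qr φlo ET - apexRest (w 2) z zb a₀ qd qr φlo ET) *
          (w 3 a₀ * ((1 - z a₀) * (1 - zb a₀)) ^ shi - apexRest (w 3) z zb a₀ qd qr slo ET))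
    {ℓ : ℕ} {a b : ℝ} (ha : (ℓ : ℝ) + 1 ≤ a) (haτ : (ℓ : ℝ) + τ ≤ a) (nF : ℕ)
    (hnF : E₀ ≤ a + ((nF : ℝ) + 1))
    (hX : 0 ≤ singletHeadXM z zb w ℓ a b φlo φhi nF) (hY : 0 ≤ singletHeadYM z zb w ℓ a b slo shi nF)
    (hdet : singletHeadZM z zb w ℓ a b φlo φhi slo shi nF ^ 2 ≤
      4 * singletHeadXM z zb w ℓ a b φlo φhi nF * singletHeadYM z zb w ℓ a b slo shi nF) :
    ∀ p ∈ Q, ∀ Δ ∈ Ico a b, (ofPoints z zb w).SingletPositive p.1 p.2 Δ ℓ := by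
  intro p hp
  have hT := singletTermForm_nonneg_of_apex z zb w hz hzb hord a₀ qd qr hqd hqr hdomd hdomr h12 h3
    hXT hYT hZT
  refine singletPositive_ofPoints_of_headSumsM_Ico z zb w hz hzb ha (headSet ℓ nF) _ _ _ ?_ ?_ ?_ hX
    hY hdet ?_
  · intro q _ Δ hΔ
    exact (cornerBound₂_le _ _ z zb hz hzb q.2
      (⟨by linarith [hΔ.1], by linarith [hΔ.2]⟩ : Δ + (q.1 : ℝ) ∈ Icc (a + q.1) (b + q.1))
      (⟨(hQ p hp).1.1, (hQ p hp).1.2⟩ : p.1 ∈ Icc φlo φhi)).trans_eq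
      (sum45_eq_twoWeightEval _ _ z zb _ _).symm
  · intro q _ Δ hΔ
    exact termCornerBound_le (w 3) z zb hz hzb q.2
      (⟨by linarith [hΔ.1], by linarith [hΔ.2]⟩ : Δ + (q.1 : ℝ) ∈ Icc (a + q.1) (b + q.1))
      ⟨(hQ p hp).2.1, (hQ p hp).2.2⟩
  · intro q _ Δ hΔ
    exact abs_sum56_le_singletOffDiagAbs z zb w hz hzb q.2
      (⟨by linarith [hΔ.1], by linarith [hΔ.2]⟩ : Δ + (q.1 : ℝ) ∈ Icc (a + q.1) (b + q.1))
      ⟨by linarith [(hQ p hp).1.1, (hQ p hp).2.1], by linarith [(hQ p hp).1.2, (hQ p hp).2.2]⟩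
  · intro q hq hr E hE x y
    have hjb : (q.2 : ℝ) + τ ≤ E := by
      have h2 : (q.2 : ℝ) ≤ (ℓ : ℝ) + q.1 := by exact_mod_cast hr.2.1
      linarith [hE.1]
    have hjE : (q.2 : ℝ) ≤ E := by
      have h2 : (q.2 : ℝ) ≤ (ℓ : ℝ) + q.1 := by exact_mod_cast hr.2.1
      linarith [hE.1]
    have hE0 : E₀ ≤ E := (headSet_off hnF q hq hr).trans hE.1
    by_cases hET : E < ET
    · exact hM q.2 E hE0 hET hjb p hp x y
    · exact hT E (not_lt.1 hET) q.2 hjE p.1 ⟨(hQ p hp).1.1, (hQ p hp).1.2⟩ p.2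
        ⟨(hQ p hp).2.1, (hQ p hp).2.2⟩ x y

/-! ### `V` rows: the bound cell through the odd bridge -/

/-- **The `V` bound-cell number** on the `Δ`-cell `[a, b)` of spin `ℓ ≥ 1`, `ℓ + 1 ≤ a`, head level
`n_F`: the `σ–ε` odd bound number (tables of `(Δ-ℓ-1)·A_{n,j}(c,c;Δ,ℓ)`) at the odd weights of the point
7-vector. [cite: DolanOsborn2004, §3 eq. (3.11)] -/
def vectorHeadNumberBd {n : ℕ} (z zb : Fin n → ℝ) (w : Fin 7 → Fin n → ℝ) (ℓ : ℕ)
    (c₁ c₂ a b φlo φhi : ℝ) (nF : ℕ) : ℝ :=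
  oddHeadNumberBd z zb (oddWeights w) ℓ c₁ c₂ a b φlo φhi nF

/-- The `V` bound-cell number written out: `Σ_{(n,j) ∈ headSet ℓ n_F} min(BdLo·Φlo, BdHi·Φlo)` with
`Φlo_{n,j} = cornerBound₂ (w₅−w₆−|w₄|) (w₅+w₆+|w₄|) j (a+n) (b+n) φ_lo φ_hi`.
[cite: DolanOsborn2004, §3 eq. (3.11)] -/
theorem vectorHeadNumberBd_eq {n : ℕ} (z zb : Fin n → ℝ) (w : Fin 7 → Fin n → ℝ) (ℓ : ℕ)
    (c₁ c₂ a b φlo φhi : ℝ) (nF : ℕ) :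
    vectorHeadNumberBd z zb w ℓ c₁ c₂ a b φlo φhi nF =
      oddHeadCellSumBd ℓ c₁ c₂ a b (headSet ℓ nF) (fun q =>
        cornerBound₂ (fun k => w 5 k - w 6 k - |w 4 k|) (fun k => w 5 k + w 6 k + |w 4 k|) z zb q.2
          (a + q.1) (b + q.1) φlo φhi) := by
  simp only [vectorHeadNumberBd, oddHeadNumberBd, oddWeights_two, oddWeights_three, oddWeights_four]

/-- **One light `V` cell of a spinning row starting at (or above) `ℓ + 1`, from its bound number.**
As `vectorCell_of_headNumber` with `ℓ ≥ 1`, `ha : ℓ + 1 ≤ a` and `vectorHeadNumberBd ≥ 0`; through the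
bridge from `oddCellBd_of_headNumber`. [cite: KosPolandSimmonsduffin2014, §3.3 eq. (3.16)] -/
theorem vectorCellBd_of_headNumber {n : ℕ} (z zb : Fin n → ℝ) (w : Fin 7 → Fin n → ℝ)
    (hz : ∀ k, z k ∈ Ioo (0 : ℝ) 1) (hzb : ∀ k, zb k ∈ Ioo (0 : ℝ) 1) (hord : ∀ k, zb k ≤ z k)
    (a₀ : Fin n) (qd qr : Fin n → ℝ) (hqd : ∀ k, 0 < qd k ∧ qd k ≤ 1)
    (hqr : ∀ k, 0 < qr k ∧ qr k ≤ 1)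
    (hdomd : ∀ k, z k * zb k ≤ qd k ^ 2 * (z a₀ * zb a₀) ∧ z k ≤ qd k * z a₀)
    (hdomr : ∀ k, (1 - z k) * (1 - zb k) ≤ qr k ^ 2 * (z a₀ * zb a₀) ∧ 1 - zb k ≤ qr k * z a₀)
    {Q : Set (ℝ × ℝ)} {φlo φhi slo shi c₁ c₂ E₀ ET τ : ℝ}
    (hQ : ∀ p ∈ Q, (φlo ≤ p.1 ∧ p.1 ≤ φhi) ∧ (slo ≤ p.2 ∧ p.2 ≤ shi))
    (hQc : ∀ p ∈ Q, c₁ ≤ (p.1 - p.2) / 2 ∧ (p.1 - p.2) / 2 ≤ c₂)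
    (hMV : ∀ (j : ℕ) (E : ℝ), E₀ ≤ E → E < ET → (j : ℝ) + τ ≤ E → ∀ p ∈ Q,
      0 ≤ oddDomEval z zb (oddWeights w) p.1 (zMono E j))
    (hcV : 0 ≤ w 5 a₀ - w 6 a₀ - |w 4 a₀|)
    (hTV : apexRest (w 5) z zb a₀ qd qr φlo ET + apexRest (w 6) z zb a₀ qd qr φlo ET +
        apexRest (fun k => |w 4 k|) z zb a₀ qd qr φlo ET ≤
      (w 5 a₀ - w 6 a₀ - |w 4 a₀|) * ((1 - z a₀) * (1 - zb a₀)) ^ φhi)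
    {ℓ : ℕ} {a b : ℝ} (hℓ : 1 ≤ ℓ) (ha : (ℓ : ℝ) + 1 ≤ a) (haτ : (ℓ : ℝ) + τ ≤ a) (nF : ℕ)
    (hnF : E₀ ≤ a + ((nF : ℝ) + 1))
    (hnum : 0 ≤ vectorHeadNumberBd z zb w ℓ c₁ c₂ a b φlo φhi nF) :
    ∀ p ∈ Q, ∀ Δ ∈ Ico a b, (ofPoints z zb w).VectorPositive p.1 p.2 Δ ℓ :=
  fun p hp Δ hΔ => (vectorPositive_ofPoints_iff z zb w p.1 p.2 Δ ℓ).2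
    (oddCellBd_of_headNumber z zb (oddWeights w) hz hzb hord a₀ qd qr hqd hqr hdomd hdomr hQ hQc hMV
      (by simpa only [oddWeights_two, oddWeights_three, oddWeights_four] using hcV)
      (by simpa only [oddWeights_two, oddWeights_three, oddWeights_four] using hTV) hℓ ha haτ nF hnF
      hnum p hp Δ hΔ)

/-! ### The spinning items with a bound cell first -/

/-- **The item `spinning_S` of one even spin `ℓ ≠ 0` with its first cell at the bound**: breakpoints
`t` with `t 0 = ℓ + 1`, `E₀ ≤ t m`, every cell `[t_i, t_{i+1})` certified (cell `0` by
`singletCellM_of_headNumbers`, the others by either cell theorem).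
[cite: KosPolandSimmonsDuffinVichi2015, §2.2 (functional conditions)] -/
theorem spinning_S_of_cells_bound {N : ℕ} (z zb : Fin N → ℝ) (w : Fin 7 → Fin N → ℝ)
    {Q : Set (ℝ × ℝ)} {ℓ : ℕ} {E₀ : ℝ} (t : ℕ → ℝ) (m : ℕ)
    (h0 : t 0 = (ℓ : ℝ) + 1) (hhi : E₀ ≤ t m)
    (hcell : ∀ i < m, ∀ p ∈ Q, ∀ Δ ∈ Ico (t i) (t (i + 1)),
      (ofPoints z zb w).SingletPositive p.1 p.2 Δ ℓ) :
    ∀ p ∈ Q, ∀ Δ : ℝ, (ℓ : ℝ) + 1 ≤ Δ → Δ < E₀ → (ofPoints z zb w).SingletPositive p.1 p.2 Δ ℓ :=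
  spinning_S_of_cells z zb w t m h0.le hhi hcell

/-- **The item `spinning_V` of one spin `ℓ ≠ 0` with its first cell at the bound.**
[cite: KosPolandSimmonsDuffinVichi2015, §2.2 (functional conditions)] -/
theorem spinning_V_of_cells_bound {n : ℕ} (z zb : Fin n → ℝ) (w : Fin 7 → Fin n → ℝ)
    {Q : Set (ℝ × ℝ)} {ℓ : ℕ} {E₀ : ℝ} (t : ℕ → ℝ) (m : ℕ)
    (h0 : t 0 = (ℓ : ℝ) + 1) (hhi : E₀ ≤ t m)
    (hcell : ∀ i < m, ∀ p ∈ Q, ∀ Δ ∈ Ico (t i) (t (i + 1)), (ofPoints z zb w).VectorPositive p.1 p.2 Δ ℓ) :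
    ∀ p ∈ Q, ∀ Δ : ℝ, (ℓ : ℝ) + 1 ≤ Δ → Δ < E₀ → (ofPoints z zb w).VectorPositive p.1 p.2 Δ ℓ :=
  spinning_V_of_cells z zb w t m h0.le hhi hcell

end ArchipelagoFunctional

end Literature.MathematicalPhysics.QuantumFieldTheory.ONArchipelagoSystem
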